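import Mathlib
import HarnessLib
import Literature.MathematicalPhysics.QuantumFieldTheory.ConstructiveQFTWave0

/-!
# LatticeQCDFlow / Scaling — the comb (axial spanning tree) of the discrete torus and link fixing

HONEST FRAMING: exact (Metropolis-corrected) sampling algorithms for lattice gauge theory;
figures of merit are autocorrelation/cost numbers at stated couplings and volumes; no
continuum-physics claim.

Venture `LatticeQCDFlow` (cell pub-lqcd), topic `Scaling`, THEORY-2.md §3.2 v2.1 / §4 row T2-AH(c′)
(theory seat GEN-10, R-T2-10).  Combinatorial half of the tree-gauge argument proving
`TreeGaugeSmallBallBound` (companion file `Scaling/LatticeTreeGauge.lean`, which does the measure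
theory).  Over the torus vocabulary of `ConstructiveQFTWave0` §S11 (`Site d L = Fin d → ZMod L`,
`Edge d L = Site d L × Fin d`, `Site.shift`, `GaugeConfig`, `gaugeTransform`, `wilsonAction`):

* §1 the **comb** `treeEdges d L`: the edge `(x, i)` belongs to the comb iff `x_j = 0` for all
  `j < i` and it does not wrap (`x_i + 1 < L`); `head e = x + e_i`.  Every site `x ≠ 0` is the head
  of a comb edge (`exists_mem_treeEdges_head_eq`: lower the first non-zero coordinate), so
  `#V − 1 ≤ #comb` (`card_site_sub_one_le_card_treeEdges`); two comb edges with the same head are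
  equal (`eq_of_head_eq`), and a comb edge starting at the head of the comb edge `a` has
  `rank = rank a + 1`, where `rank e = Σ_j (head e)_j`; hence (`free_of_max`) among the comb edges
  of rank `≤ rank a`, none other than `a` touches `head a` — the leaf-by-leaf order used for gauge
  fixing.  (The comb is in fact a spanning tree with exactly `L^d − 1` edges; only the inequality
  is needed.)
* §2 **link fixing** `fixOne s U` (set the links of `s` to `1`) and its interaction with
  `Function.update` and with gauge transformations supported away from the fixed links
  (`fixOne_gaugeTransform`, `gaugeTransform_update`), plus the action bound `wilsonAction_le_of_mem`
  on configurations with all links in `insert 1 (B ∪ B⁻¹)` (as in `smallBallBound`).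

References for the tree/axial gauge: M. Creutz, *Quarks, gluons and lattices* (1983) Ch. 9;
E. Seiler, LNP 159 (1982) Ch. 2; S. Chatterjee, arXiv:1602.01222 §9.  Everything is proved,
`[folklore]` level, no `sorry`; no definition of the venture is changed.
-/

noncomputable section

open Function Literature.MathematicalPhysics.QuantumFieldTheory

namespace Summit.Ventures.LatticeQCDFlow.Theory2.Lattice

/-! ## 1. The comb (axial spanning tree) of the discrete torus -/

section Comb

variable {d L : ℕ}

/-- The head `x + eᵢ` of the edge `(x, i)`. [folklore] -/
def head (e : Edge d L) : Site d L := e.1.shift e.2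

open scoped Classical in
/-- The **comb** (axial tree) of the torus: `(x, i)` is a comb edge iff the coordinates of `x`
below `i` vanish and the edge does not wrap around the torus. [folklore] -/
def treeEdges (d L : ℕ) [NeZero L] : Finset (Edge d L) :=
  Finset.univ.filter fun e => (∀ j : Fin d, j < e.2 → e.1 j = 0) ∧ (e.1 e.2).val + 1 < L

/-- Membership in the comb, unfolded. [folklore] -/
theorem mem_treeEdges [NeZero L] {e : Edge d L} :
    e ∈ treeEdges d L ↔ (∀ j : Fin d, j < e.2 → e.1 j = 0) ∧ (e.1 e.2).val + 1 < L := by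
  classical
  unfold treeEdges
  rw [Finset.mem_filter]
  simp

/-- The rank of an edge: the `ℓ¹`-size of its head (its depth in the comb). [folklore] -/
def rank [NeZero L] (e : Edge d L) : ℕ := ∑ j, ((head e) j).val

/-- Coordinates of the shifted site `x + eᵢ`. [folklore] -/
theorem shift_apply (x : Site d L) (i j : Fin d) :
    (x.shift i) j = x j + if j = i then 1 else 0 := by
  simp [Site.shift, Pi.single_apply]

/-- In `ZMod L`: if `w + 1` does not wrap then `val (w + 1) = val w + 1`. [folklore] -/
theorem val_add_one_of_lt [NeZero L] {w : ZMod L} (h : w.val + 1 < L) :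
    (w + 1).val = w.val + 1 := by
  haveI : Fact (1 < L) := ⟨by omega⟩
  rw [ZMod.val_add, ZMod.val_one, Nat.mod_eq_of_lt h]

/-- A non-wrapping increment in `ZMod L` is non-zero. [folklore] -/
theorem add_one_ne_zero_of_lt [NeZero L] {w : ZMod L} (h : w.val + 1 < L) : w + 1 ≠ 0 := by
  intro h0
  have h1 := val_add_one_of_lt h
  rw [h0, ZMod.val_zero] at h1
  omega

/-- A comb edge is not a loop: its head differs from its tail. [folklore] -/
theorem head_ne_fst [NeZero L] {e : Edge d L} (he : e ∈ treeEdges d L) : head e ≠ e.1 := by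
  intro h
  have h1 := congrFun h e.2
  rw [head, shift_apply, if_pos rfl] at h1
  have h2 := val_add_one_of_lt (mem_treeEdges.mp he).2
  rw [h1] at h2
  omega

/-- A comb edge starting at the head of the comb edge `a` has rank `rank a + 1`. [folklore] -/
theorem rank_of_fst_eq_head [NeZero L] {a b : Edge d L} (hb : b ∈ treeEdges d L)
    (h : b.1 = head a) : rank b = rank a + 1 := by
  have key : ∀ j, ((head b) j).val = ((head a) j).val + if j = b.2 then 1 else 0 := by
    intro j
    have hb2 : (b.1 b.2).val + 1 < L := (mem_treeEdges.mp hb).2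
    rw [h] at hb2
    show ((b.1.shift b.2) j).val = _
    rw [shift_apply, h]
    by_cases hj : j = b.2
    · subst hj
      rw [if_pos rfl, if_pos rfl]
      exact val_add_one_of_lt hb2
    · rw [if_neg hj, if_neg hj, add_zero, add_zero]
  unfold rank
  simp_rw [key]
  rw [Finset.sum_add_distrib]
  simp

/-- Two comb edges with the same head: the direction of the second is not below that of the
first. [folklore] -/
theorem not_lt_of_shift_eq [NeZero L] {y z : Site d L} {i k : Fin d}
    (ha : ((y, i) : Edge d L) ∈ treeEdges d L) (hb : ((z, k) : Edge d L) ∈ treeEdges d L)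
    (h : y.shift i = z.shift k) : ¬ k < i := by
  intro hki
  have h1 := congrFun h k
  rw [shift_apply, shift_apply, if_neg (ne_of_lt hki), if_pos rfl, add_zero] at h1
  have h0 : y k = 0 := (mem_treeEdges.mp ha).1 k hki
  have hz : (z k).val + 1 < L := (mem_treeEdges.mp hb).2
  rw [h0] at h1
  exact add_one_ne_zero_of_lt hz h1.symm

/-- **Comb edges are determined by their heads.** [folklore] -/
theorem eq_of_head_eq [NeZero L] {a b : Edge d L} (ha : a ∈ treeEdges d L)
    (hb : b ∈ treeEdges d L) (h : head a = head b) : a = b := by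
  obtain ⟨y, i⟩ := a
  obtain ⟨z, k⟩ := b
  simp only [head] at h
  have h1 := not_lt_of_shift_eq ha hb h
  have h2 := not_lt_of_shift_eq hb ha h.symm
  have hik : i = k := le_antisymm (not_lt.mp h1) (not_lt.mp h2)
  subst hik
  have hyz : y = z := by
    have h' := h
    simp only [Site.shift] at h'
    exact add_right_cancel h'
  subst hyz
  rfl

/-- Among comb edges of rank at most `rank a`, no edge other than `a` touches `head a`. [folklore] -/
theorem free_of_max [NeZero L] {a b : Edge d L} (ha : a ∈ treeEdges d L)
    (hb : b ∈ treeEdges d L) (hab : b ≠ a) (hr : rank b ≤ rank a) :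
    b.1 ≠ head a ∧ head b ≠ head a := by
  refine ⟨fun h => ?_, fun h => hab (eq_of_head_eq hb ha h)⟩
  have := rank_of_fst_eq_head hb h
  omega

/-- **Every site other than the origin is the head of a comb edge** (lower its first non-zero
coordinate by one). [folklore] -/
theorem exists_mem_treeEdges_head_eq [NeZero L] (x : Site d L) (hx : x ≠ 0) :
    ∃ e ∈ treeEdges d L, head e = x := by
  classical
  have hne : (Finset.univ.filter fun j => x j ≠ 0).Nonempty := by
    by_contra hc
    rw [Finset.not_nonempty_iff_eq_empty, Finset.filter_eq_empty_iff] at hc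
    exact hx (funext fun j => by simpa using hc (Finset.mem_univ j))
  set i := (Finset.univ.filter fun j => x j ≠ 0).min' hne with hi
  have hi0 : x i ≠ 0 := by
    have hm := Finset.min'_mem _ hne
    rw [Finset.mem_filter] at hm
    exact hm.2
  have hmin : ∀ j, j < i → x j = 0 := by
    intro j hj
    by_contra hxj
    have hle : i ≤ j :=
      Finset.min'_le (Finset.univ.filter fun j => x j ≠ 0) j
        (Finset.mem_filter.mpr ⟨Finset.mem_univ j, hxj⟩)
    exact absurd hj (not_lt.mpr hle)
  refine ⟨(x - Pi.single i 1, i), mem_treeEdges.mpr ⟨?_, ?_⟩, ?_⟩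
  · intro j hj
    dsimp only at hj ⊢
    rw [Pi.sub_apply, Pi.single_eq_of_ne (ne_of_lt hj), sub_zero]
    exact hmin j hj
  · dsimp only
    rw [Pi.sub_apply, Pi.single_eq_same]
    by_contra hc
    push Not at hc
    have hlt := ZMod.val_lt (x i - 1)
    have hv : (x i - 1).val = L - 1 := by omega
    have hpos : 0 < (x i).val := Nat.pos_of_ne_zero (by rwa [ne_eq, ZMod.val_eq_zero])
    have hL : 1 < L := by have := ZMod.val_lt (x i); omega
    haveI : Fact (1 < L) := ⟨hL⟩
    have h0 : (x i - 1 + 1).val = 0 := by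
      rw [ZMod.val_add, hv, ZMod.val_one, Nat.sub_add_cancel hL.le, Nat.mod_self]
    rw [sub_add_cancel, ZMod.val_eq_zero] at h0
    exact hi0 h0
  · simp [head, Site.shift]

/-- **Counting the comb**: at least `#V − 1` edges. [folklore] -/
theorem card_site_sub_one_le_card_treeEdges [NeZero L] :
    Fintype.card (Site d L) - 1 ≤ (treeEdges d L).card := by
  classical
  have hsub : Finset.univ.erase (0 : Site d L) ⊆ (treeEdges d L).image head := by
    intro x hx
    obtain ⟨e, he, hex⟩ := exists_mem_treeEdges_head_eq x (Finset.mem_erase.mp hx).1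
    exact Finset.mem_image.mpr ⟨e, he, hex⟩
  calc Fintype.card (Site d L) - 1 = (Finset.univ.erase (0 : Site d L)).card := by
        rw [Finset.card_erase_of_mem (Finset.mem_univ _), Finset.card_univ]
    _ ≤ ((treeEdges d L).image head).card := Finset.card_le_card hsub
    _ ≤ (treeEdges d L).card := Finset.card_image_le

end Comb

/-! ## 2. Gauge fixing on the level of configurations -/

section Config

variable {d L N : ℕ} {G : Type*} [Group G]

/-- Set the links of `s` to `1`. [folklore] -/
def fixOne (s : Finset (Edge d L)) (U : GaugeConfig d L G) : GaugeConfig d L G :=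
  fun e => if e ∈ s then 1 else U e

/-- Fixing no link does nothing. [folklore] -/
@[simp] theorem fixOne_empty (U : GaugeConfig d L G) : fixOne ∅ U = U := by
  funext e
  simp [fixOne]

/-- Fixing the links of `s` after setting the link `a` to `1` = fixing the links of `insert a s`.
[folklore] -/
theorem fixOne_update (s : Finset (Edge d L)) (a : Edge d L) (U : GaugeConfig d L G) :
    fixOne s (update U a 1) = fixOne (insert a s) U := by
  funext e
  by_cases he : e ∈ s
  · simp [fixOne, he]
  · by_cases hea : e = a
    · subst hea
      simp [fixOne]
    · simp [fixOne, he, hea]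

/-- Setting links to `1` commutes with a gauge transformation supported at a site `x` that
touches none of those links. [folklore] -/
theorem fixOne_gaugeTransform (s : Finset (Edge d L)) {x : Site d L}
    (hs : ∀ e ∈ s, e.1 ≠ x ∧ head e ≠ x) (γ : Site d L → G) (hγ : ∀ z, z ≠ x → γ z = 1)
    (U : GaugeConfig d L G) :
    fixOne s (gaugeTransform γ U) = gaugeTransform γ (fixOne s U) := by
  funext e
  by_cases he : e ∈ s
  · have h1 := hγ _ (hs e he).1
    have h2 := hγ _ (hs e he).2
    simp only [head] at h2
    simp [fixOne, gaugeTransform, he, h1, h2]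
  · simp [fixOne, gaugeTransform, he]

/-- The gauge transformation `γ` with `γ(tail e₀) = 1`, `γ(head e₀) = g` sends `U[e₀ ↦ g]` to
`(U^γ)[e₀ ↦ 1]`. [folklore] -/
theorem gaugeTransform_update (e₀ : Edge d L) (γ : Site d L → G) (g : G) (h1 : γ e₀.1 = 1)
    (h2 : γ (head e₀) = g) (U : GaugeConfig d L G) :
    gaugeTransform γ (update U e₀ g) = update (gaugeTransform γ U) e₀ 1 := by
  funext e
  by_cases he : e = e₀
  · subst he
    simp only [head] at h2
    simp [gaugeTransform, h1, h2]
  · simp [gaugeTransform, update_of_ne he]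

variable (ρ : G →* Matrix (Fin N) (Fin N) ℂ)

/-- A configuration all of whose links (and their inverses) lie in `insert 1 (B ∪ B⁻¹)` has action
`≤ s·#plaquettes` when `s` bounds the plaquette term on four-fold products from that set. [folklore] -/
theorem wilsonAction_le_of_mem [NeZero L] {B : Set G} {s : ℝ}
    (hs : ∀ g₁ ∈ insert (1 : G) (B ∪ B⁻¹), ∀ g₂ ∈ insert (1 : G) (B ∪ B⁻¹),
      ∀ g₃ ∈ insert (1 : G) (B ∪ B⁻¹), ∀ g₄ ∈ insert (1 : G) (B ∪ B⁻¹),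
        (N : ℝ) - (ρ (g₁ * g₂ * g₃ * g₄)).trace.re ≤ s)
    (U : GaugeConfig d L G) (hmem : ∀ e, U e ∈ insert (1 : G) (B ∪ B⁻¹))
    (hmem' : ∀ e, (U e)⁻¹ ∈ insert (1 : G) (B ∪ B⁻¹)) :
    wilsonAction ρ U ≤ s * Fintype.card (Plaquette d L) := by
  unfold wilsonAction
  calc ∑ p : Plaquette d L, ((N : ℝ) - (ρ (plaquetteHolonomy U p.1 p.2.1.1 p.2.1.2)).trace.re)
      ≤ ∑ _p : Plaquette d L, s := Finset.sum_le_sum fun p _ => by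
        unfold plaquetteHolonomy
        exact hs _ (hmem _) _ (hmem _) _ (hmem' _) _ (hmem' _)
    _ = s * Fintype.card (Plaquette d L) := by
        rw [Finset.sum_const, Finset.card_univ, nsmul_eq_mul, mul_comm]

end Config

end Summit.Ventures.LatticeQCDFlow.Theory2.Lattice
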